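import Literature.AlgebraicGeometry.Resolution.InseparableLocalUniformizationDefectStep
import Literature.AlgebraicGeometry.Resolution.InseparableLocalUniformizationLemmasProofs
import Literature.AlgebraicGeometry.Resolution.ValuationRingOpenInNormalizationProofs
import Literature.AlgebraicGeometry.Resolution.InseparableLocalUniformizationHeightInduction
import HarnessLib

/-!
# Inseparable local uniformization: Step 3 of the proof of Thm. 4.1.1 (Temkin 2013), proved

Topic: `Literature/AlgebraicGeometry/Resolution`. M. Temkin, *Inseparable local uniformization*,
J. Algebra 373 (2013) 65–119 = arXiv:0804.1554v3 (numbering of this version; in the 41-pp.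
arXiv version held in the literature store the proof of Thm. 4.1.1 is on pp. 29–30 and
Lemma 2.8.4 is Lemma 2.7.4). This file PROVES **Step 3** of the proof of Thm. 4.1.1 (pp. 48–49
of v3, p. 30 of the held copy) in the affine vocabulary of the named fact
`Temkin2013_Steps34_tower` (`InseparableLocalUniformizationEngineTower.lean`, the corrected
rendering of `Temkin2013_Steps34`), for `n = 1`:

  "Step 3. Refine `Y` and replace the other entries of diagram (3) with the `η`-normalized base
  changes so that `xᵢ` and `yᵢ` become smooth-equivalent. … Let `{Y_α}_{α ∈ A}` be the
  projective family of all affine refinements of `Y` (i.e. they are `k`-models of `k̄°`). This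
  family is filtered and `S →~ proj lim_α Y_α`. Note that `X_α := Nr_η(X ×_Y Y_α)` is a normalized
  `k`-model of `K°` which refines `X` … `X_{i,α} := Nr_{Kᵢ}(X_α)`, `Y_{i,α} := Nr_{mᵢ}(Y_α)` …
  Recall that `Sᵢ` is open in `Nr_{mᵢ}(S)` (this is even true for any valuation ring of finite
  height). Finally, let `x_{i,α} ∈ X_{i,α}` and `y_{i,α} ∈ Y_{i,α}` be the centers of `Kᵢ` and
  `mᵢ`, respectively. Obviously, they are the images of `zᵢ` and `sᵢ`, respectively, hence by
  Lemma 2.8.4 there exists `α` such that the points `x_{i,α}` and `y_{i,α}` are smooth-equivalent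
  over `Y_α` for each `1 ≤ i ≤ n`."

* `step3_exists_level` — PROVED: in the situation of `Temkin2013_Steps34_tower` (base `k̄ ⊆ K`
  with `k̄° = K° ∩ k̄` of finite height, affine model `Y = Spec B` of `k̄°`, affine model
  `X = Spec A` of `K°` over `Y`, finite valued extensions `(K₁, K₁°)/(K, K°)` and `(m, m°)/(k̄, k̄°)`,
  and the smooth-equivalence over `S = Spec k̄°` of the centre `z₁` of `K₁°` on
  `C₁ = Nr_{K₁}(X ×_Y S) = etaModel k̄ C k̄°`, `C = Nr_{K₁}(A)`, with the closed point `s₁` of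
  `S₁ = Spec m°`), there is an affine refinement `Y₁ = Spec B₁` of `Y` such that for EVERY affine
  refinement `Y′ = Spec B′` of `Y₁` inside `k̄°` the centre `x_{1,B′}` of `K₁°` on
  `X_{1,B′} = Nr_{K₁}(X ×_Y Y′) = etaModel k̄ C B′` and the centre `y_{1,B′}` of `m°` on
  `Y_{1,B′} = Nr_m(Y′) = Nr_m(B′)` are smooth-equivalent over `Y′`.
  Proof as printed: `S₁ = Spec m°` is the basic open `D(f)` of `Nr_m(S) = Spec Nr_m(k̄°)`
  (`Temkin2013_valuationRingOpen_holds`), so `Nr_m(S) → S₁` is smooth and `z₁` is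
  smooth-equivalent over `S` to the image `y` of `s₁` in `Nr_m(S)`
  (`AreSmoothEquivalent.of_smooth_right`); `Nr_m(S) = etaModel k̄ (Nr_m B) k̄°` and
  `Nr_m(Y′) = etaModel k̄ (Nr_m B) B′`; the affine refinements of `Y` inside `k̄°` form a directed
  family with union `k̄°`, and Lemma 2.8.4 "⇒" (`Temkin2013_Lemma284_holds`, with
  `C = Nr_{K₁}(A)` and `C′ = Nr_m(B)`, both finitely generated over `B` by E. Noether's
  finiteness of integral closure and with integrally closed generic fibres,
  `mem_adjoin_of_isIntegral_adjoin`) gives the level `α₁ = B₁`.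
* Bricks: `isLocalizationAway_of_generator` (`m° = Nr_m(k̄°)[1/f]` as an `IsLocalization.Away`
  instance), `nrIn_sup_eq_of_le_nrIn`, `areSmoothEquivalent_congr₂` (transport of
  smooth-equivalence data along equalities of the model subrings on both sides).

## Sources

* M. Temkin, *Inseparable local uniformization*, arXiv:0804.1554v3: proof of Thm. 4.1.1, Step 3
  (pp. 48–49); Lemma 2.8.4 (p. 31); Prop. 2.3.8 (i) (p. 14).

## Rendering notes

* As in `Temkin2013_Steps34_tower`: `k̄` acts on `K₁` through `K` (no separate binder);
  `k̄° = O.comap (algebraMap k̄ K)` and `C = Nr_{K₁}(A) = nrIn (A.map (K → K₁))` enter as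
  variables `Ob`, `C` with defining equations (keeps the proof terms small); `Nr_K ↦ nrIn`;
  `Nr_{K₁}(X ×_Y Y′) ↦ etaModel k̄ C B′`; `Nr_m(Y′) ↦ nrIn (B′.map (k̄ → m))`; points are
  contractions of maximal ideals of valuation rings (`Subring.inclusion`), structure maps are
  `codRestrict`s of `k̄ → K₁`, `k̄ → m` (`etaModelBaseMap` unfolds to this form).
-/

noncomputable section

open IsLocalRing

namespace Literature.AlgebraicGeometry.Resolution

universe u

/-! ### Bricks -/

section bricks

variable {K : Type u} [Field K]

/-- `Nr_K(T·S) = Nr_K(S)` when `T` is integral over `S`. [folklore] -/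
theorem nrIn_sup_eq_of_le_nrIn {T S : Subring K} (h : T ≤ nrIn S) : nrIn (T ⊔ S) = nrIn S :=
  nrIn_eq_nrIn_of_le_of_le (sup_le h (le_nrIn S)) (le_sup_right.trans (le_nrIn _))

/-- Integrality over a subring passes to any larger subring. [folklore] -/
theorem isIntegral_of_subring_le {T T' : Subring K} (h : T ≤ T') {x : K} (hx : IsIntegral T x) :
    IsIntegral T' x := by
  letI : Algebra T T' := (Subring.inclusion h).toAlgebra
  haveI : IsScalarTower T T' K := IsScalarTower.of_algebraMap_eq (fun _ => rfl)
  exact hx.tower_top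

/-- Smooth-equivalence data (with the centres of valuation rings as points and `codRestrict`ed
structure maps) are invariant under rewriting BOTH model subrings along equalities.
[folklore] -/
theorem areSmoothEquivalent_congr₂ {R₀ M : Type u} [CommRing R₀] [Field M]
    (OK : ValuationSubring K) (OM : ValuationSubring M) (φ : R₀ →+* K) (ψ : R₀ →+* M)
    {X₁ X₂ : Subring K} (hX : X₁ = X₂) {Y₁ Y₂ : Subring M} (hY : Y₁ = Y₂)
    (hX₁ : X₁ ≤ OK.toSubring) (hX₂ : X₂ ≤ OK.toSubring)
    (hY₁ : Y₁ ≤ OM.toSubring) (hY₂ : Y₂ ≤ OM.toSubring)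
    (hφ₁ : ∀ r, φ r ∈ X₁) (hφ₂ : ∀ r, φ r ∈ X₂) (hψ₁ : ∀ r, ψ r ∈ Y₁) (hψ₂ : ∀ r, ψ r ∈ Y₂) :
    AreSmoothEquivalent (φ.codRestrict X₁ hφ₁) (ψ.codRestrict Y₁ hψ₁)
        ((maximalIdeal OK).comap (Subring.inclusion hX₁))
        ((maximalIdeal OM).comap (Subring.inclusion hY₁)) ↔
      AreSmoothEquivalent (φ.codRestrict X₂ hφ₂) (ψ.codRestrict Y₂ hψ₂)
        ((maximalIdeal OK).comap (Subring.inclusion hX₂))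
        ((maximalIdeal OM).comap (Subring.inclusion hY₂)) := by
  subst hX; subst hY; exact Iff.rfl

/-- Contracting the centre of a valuation ring in two steps is contracting it in one.
[folklore] -/
theorem comap_comap_inclusion_maximalIdeal (OK : ValuationSubring K) {X₁ X₂ : Subring K}
    (h₁₂ : X₁ ≤ X₂) (h₂ : X₂ ≤ OK.toSubring) (h₁ : X₁ ≤ OK.toSubring) :
    ((maximalIdeal OK).comap (Subring.inclusion h₂)).comap (Subring.inclusion h₁₂) =
      (maximalIdeal OK).comap (Subring.inclusion h₁) := by
  rw [Ideal.comap_comap]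
  exact Ideal.ext fun _ => Iff.rfl

/-- **`m° = Nr_m(k̄°)[1/f]` as a localization** (Temkin 2013, proof of Thm. 4.1.1, Step 3, p. 49:
"Recall that `Sᵢ` is open in `Nr_{mᵢ}(S)`"; the shape delivered by
`Temkin2013_valuationRingOpen`): if `YS ⊆ W` are subrings of a field, `0 ≠ f ∈ YS` with
`f⁻¹ ∈ W`, and every element of `W` is `a / fⁿ` with `a ∈ YS`, then `W` is the localization
`YS[1/f]`. [folklore] -/
theorem isLocalizationAway_of_generator {M : Type u} [Field M] (YS W : Subring M) (hYSW : YS ≤ W)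
    (f : M) (hf0 : f ≠ 0) (hfYS : f ∈ YS) (hfinv : f⁻¹ ∈ W)
    (hW : ∀ x : M, x ∈ W → ∃ a ∈ YS, ∃ n : ℕ, x = a / f ^ n) :
    letI := (Subring.inclusion hYSW).toAlgebra
    IsLocalization.Away (⟨f, hfYS⟩ : YS) W := by
  letI := (Subring.inclusion hYSW).toAlgebra
  have halg : ∀ a : YS, (algebraMap YS W a : M) = a := fun _ => rfl
  refine IsLocalization.Away.mk _ ?_ ?_ ?_
  · refine isUnit_iff_exists_inv.mpr ⟨⟨f⁻¹, hfinv⟩, Subtype.ext ?_⟩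
    change f * f⁻¹ = 1
    exact mul_inv_cancel₀ hf0
  · intro s
    obtain ⟨a, ha, n, hs⟩ := hW s s.2
    refine ⟨n, ⟨a, ha⟩, Subtype.ext ?_⟩
    change (s : M) * f ^ n = a
    rw [hs]
    exact div_mul_cancel₀ a (pow_ne_zero n hf0)
  · intro a b hab
    refine ⟨0, ?_⟩
    have : (a : M) = b := by
      have h := congrArg (fun z : W => (z : M)) hab
      simpa only [halg] using h
    rw [Subtype.ext this]

end bricks

/-! ### Step 3 -/

section stepThree

variable {k K : Type u} [Field k] [Field K] [Algebra k K]

-- one long proof through four fields `k ⊆ k̄ ⊆ K ⊆ K₁` and `m ⊇ k̄`; the whole elaboration needs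
-- twice the default budget (no single step is expensive)
set_option maxHeartbeats 400000 in
/-- **Step 3 of the proof of Temkin's Thm. 4.1.1** (Temkin 2013, proof of Thm. 4.1.1, Step 3,
pp. 48–49: "by Lemma 2.8.4 there exists `α` such that the points `x_{i,α}` and `y_{i,α}` are
smooth-equivalent over `Y_α`", together with "Recall that `Sᵢ` is open in `Nr_{mᵢ}(S)`"), for
`n = 1`, in the affine vocabulary of `Temkin2013_Steps34_tower`: `Ob = k̄° = K° ∩ k̄` of finite
height, `C = Nr_{K₁}(A)`; given the smooth-equivalence over `S = Spec k̄°` of the centre `z₁` of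
`K₁°` on `C₁ = Nr_{K₁}(X ×_Y S) = etaModel k̄ C k̄°` with the closed point of `S₁ = Spec m°`,
there is an affine refinement `Y₁ = Spec B₁` of `Y = Spec B` (a finitely generated
`k`-subalgebra `B ⊆ B₁ ⊆ k̄°`) such that for every affine refinement `Y′ = Spec B′` of `Y₁`
inside `k̄°` the centre of `K₁°` on `X_{1,B′} = Nr_{K₁}(X ×_Y Y′) = etaModel k̄ C B′` and the
centre of `m°` on `Y_{1,B′} = Nr_m(Y′) = Nr_m(B′)` are smooth-equivalent over `Y′` (all finer
levels being allowed is the "for each `α ≥ α₀`" of Lemma 2.8.4, used by Step 4 to refine `Y`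
once more). PROVED from `Temkin2013_Lemma284_holds` and `Temkin2013_valuationRingOpen_holds`.
[cite: Temkin2013, proof of Thm. 4.1.1, Step 3 (arXiv:0804.1554v3 pp. 48–49)] -/
theorem step3_exists_level
    (O : ValuationSubring K) (hk : ∀ c : k, algebraMap k K c ∈ O)
    (kb : IntermediateField k K) (Ob : ValuationSubring kb)
    (hOb : Ob = O.comap (algebraMap kb K)) (hdim : ringKrullDim Ob < ⊤)
    (B : Subalgebra k kb) (hBO : B.toSubring ≤ Ob.toSubring) (hBfg : B.FG)
    (hBfr : IsFractionRing B kb)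
    (A : Subalgebra k K) (hAfg : A.FG) (hAfr : IsFractionRing A K)
    (hBA : ∀ b : B, algebraMap kb K b ∈ A)
    (K₁ : Type u) [Field K₁] [Algebra K K₁] [FiniteDimensional K K₁] (O₁ : ValuationSubring K₁)
    (C : Subring K₁) (hC : C = nrIn (A.toSubring.map (algebraMap K K₁)))
    (m : Type u) [Field m] [Algebra kb m] [FiniteDimensional kb m]
    (Om : ValuationSubring m) (hOm : Om.comap (algebraMap kb m) = Ob)
    (hXS : etaModel kb C Ob.toSubring ≤ O₁.toSubring)
    (hOm' : ∀ c : Ob.toSubring, ((algebraMap kb m).comp Ob.toSubring.subtype) c ∈ Om)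
    (hSE : AreSmoothEquivalent (etaModelBaseMap C Ob.toSubring)
      (((algebraMap kb m).comp Ob.toSubring.subtype).codRestrict Om hOm')
      ((maximalIdeal O₁).comap (Subring.inclusion hXS)) (maximalIdeal Om)) :
    ∃ B₁ : Subalgebra k kb, B ≤ B₁ ∧ B₁.toSubring ≤ Ob.toSubring ∧ B₁.FG ∧
      ∀ B' : Subalgebra k kb, B₁ ≤ B' → B'.toSubring ≤ Ob.toSubring → B'.FG →
      ∀ (hX : etaModel kb C B'.toSubring ≤ O₁.toSubring)
        (hY : nrIn (B'.toSubring.map (algebraMap kb m)) ≤ Om.toSubring)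
        (hBX : ∀ b : B'.toSubring,
          ((algebraMap kb K₁).comp B'.toSubring.subtype) b ∈ etaModel kb C B'.toSubring)
        (hBY : ∀ b : B'.toSubring,
          ((algebraMap kb m).comp B'.toSubring.subtype) b ∈ nrIn (B'.toSubring.map (algebraMap kb m))),
        AreSmoothEquivalent
          (((algebraMap kb K₁).comp B'.toSubring.subtype).codRestrict _ hBX)
          (((algebraMap kb m).comp B'.toSubring.subtype).codRestrict _ hBY)
          ((maximalIdeal O₁).comap (Subring.inclusion hX))
          ((maximalIdeal Om).comap (Subring.inclusion hY)) := by
  classical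
  have hkOb : ∀ c : k, algebraMap k kb c ∈ Ob := fun c => by
    rw [hOb]
    change algebraMap kb K (algebraMap k kb c) ∈ O
    rw [← IsScalarTower.algebraMap_apply]; exact hk c
  let Oalg : Subalgebra k kb := { Ob.toSubring.toSubsemiring with algebraMap_mem' := hkOb }
  have hOalg : ∀ {S : Subalgebra k kb}, S ≤ Oalg ↔ S.toSubring ≤ Ob.toSubring := fun {S} =>
    ⟨fun h x hx => h hx, fun h x hx => h hx⟩
  have hBfr' : ∀ z : kb, ∃ a ∈ B.toSubring, ∃ b ∈ B.toSubring, z = a / b := fun z => by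
    haveI := hBfr
    obtain ⟨a, b, -, rfl⟩ := IsFractionRing.div_surjective (A := B) z
    exact ⟨a, a.2, b, b.2, rfl⟩
  -- `k`-structure on `K₁` and `m` (through `K`, resp. `k̄`)
  letI : Algebra k K₁ := ((algebraMap K K₁).comp (algebraMap k K)).toAlgebra
  haveI : IsScalarTower k K K₁ := IsScalarTower.of_algebraMap_eq fun _ => rfl
  haveI : IsScalarTower k kb K₁ := IsScalarTower.of_algebraMap_eq fun c => by
    change (algebraMap K K₁) (algebraMap k K c) = algebraMap kb K₁ (algebraMap k kb c)
    rw [IsScalarTower.algebraMap_apply kb K K₁, ← IsScalarTower.algebraMap_apply k kb K]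
  letI : Algebra k m := ((algebraMap kb m).comp (algebraMap k kb)).toAlgebra
  haveI : IsScalarTower k kb m := IsScalarTower.of_algebraMap_eq fun _ => rfl
  ------------------------------------------------------------------
  -- the index category of affine refinements of `Y = Spec B` inside `k̄°`
  ------------------------------------------------------------------
  let ι : Type u := {S : Subalgebra k kb // B ≤ S ∧ S.toSubring ≤ Ob.toSubring ∧ S.FG}
  haveI : IsDirected ι (· ≤ ·) := by
    refine ⟨fun a b => ⟨⟨a.1 ⊔ b.1, le_sup_of_le_left a.2.1, ?_, a.2.2.2.sup b.2.2.2⟩,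
      (le_sup_left : a.1 ≤ a.1 ⊔ b.1), (le_sup_right : b.1 ≤ a.1 ⊔ b.1)⟩⟩
    exact hOalg.mp (sup_le (hOalg.mpr a.2.2.1) (hOalg.mpr b.2.2.1))
  let α₀ : ι := ⟨B, le_rfl, hBO, hBfg⟩
  have hα₀ : ∀ α : ι, α₀ ≤ α := fun α => α.2.1
  let Bf : ι → Subring kb := fun α => α.1.toSubring
  have hBfmono : Monotone Bf := fun a b h x hx => h hx
  have hBfnoeth : IsNoetherianRing (Bf α₀) := by
    haveI : Algebra.FiniteType k B := B.fg_iff_finiteType.mp hBfg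
    exact Algebra.FiniteType.isNoetherianRing k B
  have hBffrac : ∀ α : ι, ∀ z : kb, ∃ a ∈ Bf α, ∃ b ∈ Bf α, z = a / b := fun α z => by
    obtain ⟨a, ha, b, hb, rfl⟩ := hBfr' z
    exact ⟨a, α.2.1 ha, b, α.2.1 hb, rfl⟩
  have hBfR₀ : ∀ α : ι, Bf α ≤ Ob.toSubring := fun α => α.2.2.1
  have hcover : ∀ r ∈ Ob.toSubring, ∃ α : ι, r ∈ Bf α := fun r hr => by
    refine ⟨⟨B ⊔ Algebra.adjoin k {r}, le_sup_left, ?_, hBfg.sup ⟨{r}, by simp⟩⟩, ?_⟩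
    · refine hOalg.mp (sup_le (hOalg.mpr hBO) (Algebra.adjoin_le ?_))
      rintro _ rfl; exact hr
    · exact (le_sup_right : Algebra.adjoin k {r} ≤ B ⊔ Algebra.adjoin k {r})
        (Algebra.subset_adjoin rfl)
  ------------------------------------------------------------------
  -- `C = Nr_{K₁}(A)`: finitely generated over `B`, integrally closed generic fibre
  ------------------------------------------------------------------
  obtain ⟨N₀, hN₀set, hN₀fg, -, -⟩ := exists_normalisation_in_extension A hAfg hAfr K₁
  have hmapeq : (A.map (IsScalarTower.toAlgHom k K K₁)).toSubring =
      A.toSubring.map (algebraMap K K₁) := by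
    ext x; simp [Subring.mem_map]
  have hCN₀' : C = N₀.toSubring := by
    apply SetLike.coe_injective
    rw [hC, Subalgebra.coe_toSubring, hN₀set]
    ext x
    change x ∈ nrIn _ ↔ IsIntegral _ x
    rw [mem_nrIn_iff, ← hmapeq]
    rfl
  obtain ⟨s, hs⟩ := hN₀fg
  have hBC : (Bf α₀).map (algebraMap kb K₁) ≤ C := by
    rintro _ ⟨b, hb, rfl⟩
    rw [hC]
    refine le_nrIn _ ⟨algebraMap kb K b, hBA ⟨b, hb⟩, ?_⟩
    exact (IsScalarTower.algebraMap_apply kb K K₁ b).symm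
  have hCpres : C = Subring.closure (↑((Bf α₀).map (algebraMap kb K₁)) ∪ ↑s) := by
    apply le_antisymm
    · rw [hCN₀']
      intro x hx
      have hx' : x ∈ (Algebra.adjoin k (s : Set K₁)).toSubring := by rw [hs]; exact hx
      rw [Algebra.adjoin_eq_ring_closure] at hx'
      refine Subring.closure_mono ?_ hx'
      rintro y (⟨c, rfl⟩ | hy)
      · exact Or.inl ⟨algebraMap k kb c, B.algebraMap_mem c,
          (IsScalarTower.algebraMap_apply k kb K₁ c).symm⟩
      · exact Or.inr hy
    · rw [Subring.closure_le]
      refine Set.union_subset hBC fun y hy => ?_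
      rw [SetLike.mem_coe, hCN₀', Subalgebra.mem_toSubring, ← hs]
      exact Algebra.subset_adjoin hy
  have hCn : ∀ x : K₁, IsIntegral C x → x ∈ C := fun x hx => by
    rw [hC, ← nrIn_nrIn]
    rw [hC] at hx
    exact hx
  have hCint : ∀ z : K₁, IsIntegral (Algebra.adjoin kb (C : Set K₁)) z →
      z ∈ Algebra.adjoin kb (C : Set K₁) := fun z hz =>
    mem_adjoin_of_isIntegral_adjoin (Bf α₀) (hBffrac α₀) C hBC hCn hz
  ------------------------------------------------------------------
  -- `C' = Nr_m(B)`: finitely generated over `B`, integrally closed generic fibre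
  ------------------------------------------------------------------
  have hBOm : ∀ b : B, algebraMap kb m b ∈ Om := fun b => by
    have : (b : kb) ∈ Om.comap (algebraMap kb m) := by rw [hOm]; exact hBO b.2
    exact this
  obtain ⟨N₁, hN₁fg, -, -, hN₁mem, -⟩ := exists_integralClosure_model Om B hBOm hBfg hBfr
  obtain ⟨C', hC'⟩ : ∃ C' : Subring m, C' = nrIn (B.toSubring.map (algebraMap kb m)) := ⟨_, rfl⟩
  have hC'N₁ : C' = N₁.toSubring := by
    ext x
    rw [hC', mem_nrIn_iff, Subalgebra.mem_toSubring, hN₁mem]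
    have hmapeq' : (B.map (IsScalarTower.toAlgHom k kb m)).toSubring =
        B.toSubring.map (algebraMap kb m) := by
      ext y; simp [Subring.mem_map]
    rw [← isIntegral_map_iff (L := m) B x, ← hmapeq']
    rfl
  obtain ⟨s', hs'⟩ := hN₁fg
  have hBC' : (Bf α₀).map (algebraMap kb m) ≤ C' := by rw [hC']; exact le_nrIn _
  have hC'pres : C' = Subring.closure (↑((Bf α₀).map (algebraMap kb m)) ∪ ↑s') := by
    apply le_antisymm
    · rw [hC'N₁]
      intro x hx
      have hx' : x ∈ (Algebra.adjoin k (s' : Set m)).toSubring := by rw [hs']; exact hx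
      rw [Algebra.adjoin_eq_ring_closure] at hx'
      refine Subring.closure_mono ?_ hx'
      rintro y (⟨c, rfl⟩ | hy)
      · exact Or.inl ⟨algebraMap k kb c, B.algebraMap_mem c, rfl⟩
      · exact Or.inr hy
    · rw [Subring.closure_le]
      refine Set.union_subset hBC' fun y hy => ?_
      rw [SetLike.mem_coe, hC'N₁, Subalgebra.mem_toSubring, ← hs']
      exact Algebra.subset_adjoin hy
  have hC'n : ∀ x : m, IsIntegral C' x → x ∈ C' := fun x hx => by
    rw [hC', ← nrIn_nrIn]
    rw [hC'] at hx
    exact hx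
  have hC'int : ∀ z : m, IsIntegral (Algebra.adjoin kb (C' : Set m)) z →
      z ∈ Algebra.adjoin kb (C' : Set m) := fun z hz =>
    mem_adjoin_of_isIntegral_adjoin (Bf α₀) (hBffrac α₀) C' hBC' hC'n hz
  ------------------------------------------------------------------
  -- `Nr_m(S) = etaModel k̄ C' k̄°`, and `S₁ = Spec m°` is its basic open `D(f)`
  ------------------------------------------------------------------
  obtain ⟨YS, hYS⟩ : ∃ YS : Subring m, YS = etaModel kb C' Ob.toSubring := ⟨_, rfl⟩
  have hObmap : Ob.toSubring.map (algebraMap kb m) ≤ Om.toSubring := by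
    rintro _ ⟨c, hc, rfl⟩; exact hOm' ⟨c, hc⟩
  have hC'Ob : C' ≤ nrIn (Ob.toSubring.map (algebraMap kb m)) := by
    rw [hC']; exact nrIn_mono (fun _ ⟨b, hb, e⟩ => ⟨b, hBO hb, e⟩)
  have hYSeq : YS = nrIn (Ob.toSubring.map (algebraMap kb m)) := by
    rw [hYS]; exact nrIn_sup_eq_of_le_nrIn hC'Ob
  have hYSOm : YS ≤ Om.toSubring := by
    rw [hYSeq]; exact nrIn_le_valuationSubring Om hObmap
  have hmemYS : ∀ x : m, x ∈ YS ↔ IsIntegral (Ob.toSubring.map (algebraMap kb m)) x := fun x => by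
    rw [hYSeq]; exact mem_nrIn_iff
  -- the generator `f` of `Temkin2013_valuationRingOpen`, made non-zero
  obtain ⟨f, hf0, hfYS, hfinv, hW⟩ : ∃ f : m, f ≠ 0 ∧ f ∈ YS ∧ f⁻¹ ∈ Om ∧
      ∀ x : m, x ∈ Om.toSubring → ∃ a ∈ YS, ∃ n : ℕ, x = a / f ^ n := by
    obtain ⟨f, hfi, -, hfinv, hiff⟩ :=
      Temkin2013_valuationRingOpen_holds kb m inferInstance Ob hdim Om hOm
    by_cases hf : f = 0
    · refine ⟨1, one_ne_zero, YS.one_mem, by rw [inv_one]; exact Om.one_mem, fun x hx => ?_⟩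
      obtain ⟨a, ha, n, rfl⟩ := (hiff x).mp hx
      rcases Nat.eq_zero_or_pos n with rfl | hn
      · exact ⟨a, (hmemYS a).mpr ha, 0, by simp⟩
      · exact ⟨0, YS.zero_mem, 0, by simp [hf, zero_pow hn.ne']⟩
    · exact ⟨f, hf, (hmemYS f).mpr hfi, hfinv, fun x hx => by
        obtain ⟨a, ha, n, rfl⟩ := (hiff x).mp hx
        exact ⟨a, (hmemYS a).mpr ha, n, rfl⟩⟩
  letI algYS : Algebra YS Om := (Subring.inclusion hYSOm).toAlgebra
  haveI : IsLocalization.Away (⟨f, hfYS⟩ : YS) Om :=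
    isLocalizationAway_of_generator YS Om.toSubring hYSOm f hf0 hfYS hfinv hW
  haveI : Algebra.Smooth YS Om := Algebra.Smooth.of_isLocalization_Away (⟨f, hfYS⟩ : YS)
  -- the structure map of `S₁` factors through `Nr_m(S) → S₁`
  have hObYS : ∀ c : Ob.toSubring, ((algebraMap kb m).comp Ob.toSubring.subtype) c ∈ YS :=
    fun c => by rw [hYS]; exact map_le_etaModel C' Ob.toSubring ⟨c, c.2, rfl⟩
  have hgfac : (((algebraMap kb m).comp Ob.toSubring.subtype).codRestrict Om hOm') =
      (algebraMap YS Om).comp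
        (((algebraMap kb m).comp Ob.toSubring.subtype).codRestrict YS hObYS) :=
    RingHom.ext fun _ => Subtype.ext rfl
  rw [hgfac] at hSE
  have hSE' := AreSmoothEquivalent.of_smooth_right hSE
  -- `Nr_m(S)` in the `etaModel` form of Lemma 2.8.4
  subst hYS
  ------------------------------------------------------------------
  -- Lemma 2.8.4 "⇒"
  ------------------------------------------------------------------
  haveI hxprime : ((maximalIdeal O₁).comap (Subring.inclusion hXS)).IsPrime :=
    Ideal.comap_isPrime _ _
  haveI hyprime : ((maximalIdeal Om).comap (algebraMap _ Om)).IsPrime :=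
    Ideal.comap_isPrime (algebraMap (etaModel kb C' Ob.toSubring) Om) _
  obtain ⟨α₁, hα₁⟩ := Temkin2013_Lemma284_holds ι α₀ hα₀ kb K₁ m Bf hBfmono hBfnoeth hBffrac
    Ob.toSubring hBfR₀ hcover C s hCpres hCint C' s' hC'pres hC'int _ _ hxprime hyprime hSE'
  ------------------------------------------------------------------
  -- conclusion: the level `B₁ = B_{α₁}` and all finer levels
  ------------------------------------------------------------------
  refine ⟨α₁.1, α₁.2.1, α₁.2.2.1, α₁.2.2.2, fun B' hB₁B' hB'O hB'fg hX hY hBX hBY => ?_⟩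
  let α : ι := ⟨B', α₁.2.1.trans hB₁B', hB'O, hB'fg⟩
  have hle : α₁ ≤ α := hB₁B'
  have key := hα₁ α hle
  -- identify the level-`α` models and points with those of the statement
  have hYα : etaModel kb C' (Bf α) = nrIn (B'.toSubring.map (algebraMap kb m)) := by
    refine nrIn_sup_eq_of_le_nrIn ?_
    rw [hC']
    exact nrIn_mono (fun _ ⟨b, hb, e⟩ => ⟨b, α.2.1 hb, e⟩)
  have hYα' : etaModel kb C' (Bf α) ≤ Om.toSubring := (etaModel_mono C' (hBfR₀ α)).trans hYSOm
  have hBY' : ∀ b : B'.toSubring,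
      ((algebraMap kb m).comp B'.toSubring.subtype) b ∈ etaModel kb C' (Bf α) := fun b =>
    map_le_etaModel C' (Bf α) ⟨b, b.2, rfl⟩
  rw [comap_comap_inclusion_maximalIdeal O₁ (etaModel_mono C (hBfR₀ α)) hXS hX] at key
  have hy_eq : ((maximalIdeal Om).comap (algebraMap (etaModel kb C' Ob.toSubring) Om)).comap
      (Subring.inclusion (etaModel_mono C' (hBfR₀ α))) =
      (maximalIdeal Om).comap (Subring.inclusion hYα') :=
    comap_comap_inclusion_maximalIdeal Om (etaModel_mono C' (hBfR₀ α)) hYSOm hYα'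
  rw [hy_eq] at key
  have key' : AreSmoothEquivalent
      (((algebraMap kb K₁).comp B'.toSubring.subtype).codRestrict _ hBX)
      (((algebraMap kb m).comp B'.toSubring.subtype).codRestrict _ hBY')
      ((maximalIdeal O₁).comap (Subring.inclusion hX))
      ((maximalIdeal Om).comap (Subring.inclusion hYα')) := key
  exact (areSmoothEquivalent_congr₂ O₁ Om ((algebraMap kb K₁).comp B'.toSubring.subtype)
    ((algebraMap kb m).comp B'.toSubring.subtype) rfl hYα hX hX hYα' hY hBX hBX hBY' hBY).mp key'

end stepThree

end Literature.AlgebraicGeometry.Resolution
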